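import Summits.CriticalPhenomena.Ising3DConformalLimit.Theorems.FKParityRobustnessIndependentStrandsJoinStubCrossPairTreeBound
import HarnessLib

/-!
# Crux IndependentStrandsJoin (stmt-CriticalPhenomena-14625) — the union-cluster one-point UPPER bound

Route `FKParityRobustness`, sub-problem `Ising3DConformalLimit`; registered aux stub `stub_unionAttachUpper`: the
switching-exact UPPER partner of the open one-point floors `stub_unionAttach` (line `union-shadow-exact`, stub 3) and
`stub_soupAttach` (line `cross-fattening-decoupling`, stub 2).  On EVERY finite graph, for `β ≥ 0`, `t = tanh β`, `x ≠ y`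
and every `u`:

`Σ_{F ∈ 𝒯(xy)} Σ_{L ∈ 𝒯(∅)} t^{|F|+|L|} 1[x ↝_{F ∪ L} u] ≤ 2 · Z^{{x}∆{u}} · Z^{{u}∆{y}}`,

i.e. `P_{ℓ^{xy} ⊗ ℓ^∅}[u ∈ C(x; F ∪ L)] ≤ 2 ⟨σ_xσ_u⟩⟨σ_uσ_y⟩/⟨σ_xσ_y⟩` — the union cluster of the strand configuration and ONE
independent vacuum soup has at most (twice) the double-current one-point function.  It is the diagonal `v = w = u` of the landed
Aizenman–Duminil-Copin tree bound in loop form `Theorems.stub_crossPairTreeBound` (lead c1-0's wave), where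
`treePair G t x y u u = 2 · zPair x u · Z^∅ · zPair u y` by the coincidence convention `zPair u u = Z^∅`, and `Z^∅ > 0` cancels.

References: M. Aizenman, H. Duminil-Copin, Ann. of Math. 194 (2021), Prop. A.3 [AizenmanDuminilCopinAnnals2021].  Theorem-only file.
-/

noncomputable section

open Finset SimpleGraph
open Literature.Probability.LatticeModels
open Summit.CriticalPhenomena.Ising3DConformalLimit.Cruxes.IndependentStrandsJoin.CrossFatteningDecoupling

namespace Summit.CriticalPhenomena.Ising3DConformalLimit.Theorems

open scoped Classical BigOperators symmDiff

/-- **Registered aux stub `stub_unionAttachUpper`** (crux stmt-CriticalPhenomena-14625): the union cluster of `ℓ^{xy}` and one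
independent vacuum soup has one-point mass at most twice the double-current profile,
`Σ_{F,L} t^{|F|+|L|} 1[x ↝_{F∪L} u] ≤ 2 · Z^{{x}∆{u}} Z^{{u}∆{y}}` (`x ≠ y`, `β ≥ 0`). -/
theorem stub_unionAttachUpper :
    ∀ (V : Type) [Fintype V] [DecidableEq V] (G : SimpleGraph V) [DecidableRel G.Adj] (β : ℝ), 0 ≤ β →
      ∀ (x y u : V), x ≠ y →
      ∑ F ∈ tJoins G Set.univ {x, y}, ∑ L ∈ tJoins G Set.univ ∅,
            (if rch (F ∪ L) x u then Real.tanh β ^ (#F + #L) else 0)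
        ≤ 2 * (loopO1PartitionFunction G (Real.tanh β) ({x} ∆ {u}) *
            loopO1PartitionFunction G (Real.tanh β) ({u} ∆ {y})) := by
  intro V _ _ G _ β hβ x y u hxy
  have h := stub_crossPairTreeBound V G β hβ x y u u hxy
  have hZ0 : 0 < loopO1PartitionFunction G (Real.tanh β) ∅ :=
    loopO1PartitionFunction_empty_pos G (StubCrossPairTree.pairTree_tanh_nonneg hβ)
  have hsum : (∑ F ∈ tJoins G Set.univ {x, y}, ∑ L ∈ tJoins G Set.univ ∅,
      (if rch (F ∪ L) x u ∧ rch (F ∪ L) x u then Real.tanh β ^ (#F + #L) else 0)) =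
      ∑ F ∈ tJoins G Set.univ {x, y}, ∑ L ∈ tJoins G Set.univ ∅,
        (if rch (F ∪ L) x u then Real.tanh β ^ (#F + #L) else 0) := by
    refine Finset.sum_congr rfl fun F _ => Finset.sum_congr rfl fun L _ => ?_
    simp only [and_self]
  have huu : ({u} : Finset V) ∆ {u} = ∅ := symmDiff_self _
  have htree : treePair G (Real.tanh β) x y u u =
      loopO1PartitionFunction G (Real.tanh β) ∅ *
        (2 * (loopO1PartitionFunction G (Real.tanh β) ({x} ∆ {u}) *
          loopO1PartitionFunction G (Real.tanh β) ({u} ∆ {y}))) := by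
    unfold treePair zPair
    rw [huu]
    ring
  rw [hsum, htree] at h
  exact le_of_mul_le_mul_left h hZ0

end Summit.CriticalPhenomena.Ising3DConformalLimit.Theorems

end
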